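import Summits.Ventures.HodgeKum4.Theses.KummerFixedLocus
import Summits.Ventures.HodgeKum4.Theorems.LaneVDefs
import Summits.Ventures.HodgeKum4.Theorems.KummerFixedLocusL1HilbEval
import Summits.Ventures.HodgeKum4.Theorems.KummerFixedLocusL1HilbCert
import Summits.Ventures.HodgeKum4.Theorems.KummerFixedLocusL1HilbSuperLie
import HarnessLib

/-!
# Line `v2p5` (rebuilt on the LIVE item) for the crux `LefschetzGenerationHilb5` — the V2 mechanism in p5's cut

Crux item `stmt-Ventures-20306`, decl `Summit.Ventures.HodgeKum4.Theses.KummerFixedLocus.LefschetzGenerationHilb5`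
(`= LefschetzGenerationHilbW 5`, the (ρ3) `W`-form: L1-Hilb(5) for Chern character operators that ARE the LQW
`W`-algebra zero-modes, `ChernCharacterOperators.IsWZeroModes`).  Route `KummerFixedLocus`, cell `hodge-kum4`;
planner rebuild (plan g19, director-hodge g8 ruling 2026-08-27T12:16:42Z (R5)) of prover p5's six-stub skeleton `v2p5`
(registered 10:17:21Z on the RETIRED id stmt-Ventures-20141, sha 608ee75bec679020, stubs superLie / lehnSuper / model /
cert / eval / span) against the live `W`-form decl, using p5's LANDED stubs BY NAME:

* S-A `L1Hilb.stub_superLie` (`Theorems/KummerFixedLocusL1HilbSuperLie.lean`, p528771) — super Oberdieck Cor. 3.5;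
* S-D `L1Hilb.stub_cert : L1Hilb.LieCert` (`Theorems/KummerFixedLocusL1HilbCert.lean`, p527569) — the 447-node
  loop-superalgebra certificate, by `decide`;
* S-E `L1Hilb.stub_eval` (`Theorems/KummerFixedLocusL1HilbEval.lean`, p529005) — evaluation is full: a subspace
  `W ⊆ H*(S^[n])` stable under the blocks of `T₁(m_{b_I})` (`1 ≤ |I| ≤ 3`) and `T₋₁(Λ)` is stable under every
  single-weight number operator `τ_k(id)|ₙ` and polarisation `τ_k(b_I ⊗ b₀^∨)|ₙ`, `1 ≤ k ≤ n`.

S-B (`lehnSuper`) is NOT a stub in the `W`-form: under `IsWZeroModes`, `T₁(m_γ) = 𝔊₀(γ)` is the tree's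
`IsWZeroModes.cupOperator_zero_eq_transferOp` (LQW IMRN 2002 Thm. 4.6, `k = 0`), and `𝔊₀(γ)|ₙ` is cup product with
`G₀(γ, n) ∈ H^{|γ|}(S^[n])` (`G_degree`), so a cup-closed `W ⊇ H^{|γ|}` is `T₁(m_γ)`-stable — PROVED below
(`lehnSuper_W`).  REGISTERED STUBS (2):

* `stub_model` (S-C; p5's `…L1HilbModelAux.lean` p529928 holds its auxiliaries): for an abelian surface `A` and a
  dual Lefschetz pair `(α, Λ_A)` there is a homogeneous basis `b : Fin 16` of `H*(A)` (`b_I` of degree `|I|`, `b_0 = 1`)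
  in which left cup product by `b_I` is the exterior-algebra matrix `mulMat I` and `Λ_A` is `lamMat` (Darboux basis of
  `H¹(A)` for `α`, `H*(A) = Λ*H¹(A)`, `sl₂`-uniqueness of `Λ_A`);
* `stub_span` (S-F; cut-and-join ∕ polarisation bookkeeping): a subspace `W ⊆ H*(S^[n])` containing `1_{S^[n]}`,
  stable under Lehn's boundary operator `𝔡|ₙ` and under all `τ_k(id)|ₙ`, `τ_k(b_I ⊗ b₀^∨)|ₙ` (`1 ≤ k ≤ n`, `I ≠ 0`), for
  `W`-zero-mode Chern character operators (so `𝔡 = −𝔞_{(3)}(τ_*1)` is the explicit cubic cut-and-join operator), is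
  everything: joins reach every shape from `𝔮₋₁(1)ⁿ|0⟩`, number operators separate shapes, polarisations relabel, and
  Nakajima monomials span.

COMPOSITION (kernel-checked, no `sorry` outside the two stubs): `lefschetzGenerationHilbW_allN_of : stub_model →
stub_span → ∀ n, LefschetzGenerationHilbW n` and `LefschetzGenerationHilb5_of` concluding the route decl BY NAME.
HONEST FRAMING: conditional on the two stubs; nothing here says L1-Hilb(5) ∕ L1 ∕ HC_Kum4Type ∕ HC is proved.
-/

noncomputable section

open scoped TensorProduct DirectSum
open Literature.AlgebraicTopology.SingularHomology
open Literature.AlgebraicGeometry Literature.AlgebraicGeometry.Hyperkaehler Literature.AlgebraicGeometry.HilbertScheme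
open Literature.AlgebraicGeometry.HodgeTheory (complexBetti)
open Literature.AlgebraicGeometry.Motives (AbelianVariety ComplexPoints SchemeOver IsSmoothProjective)

namespace Summit.Ventures.HodgeKum4.Cruxes.LefschetzGenerationHilb5.V2p5

open Summit.Ventures.HodgeKum4 Summit.Ventures.HodgeKum4.L1Hilb

/-! ### S-B in the `W`-form — PROVED (not a stub) -/

/-- **S-B (`lehnSuper`), `W`-form**: for `W`-zero-mode Chern character operators, a cup-closed subspace
`W ⊆ H*(S^[n])` containing `Hˢ(S^[n])` is stable under the block of `T₁(m_γ)` for homogeneous `γ ∈ Hˢ(S)`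
(`T₁(m_γ) = 𝔊₀(γ)` acts on `ℍₙ` by cup product with `G₀(γ, n) ∈ Hˢ(S^[n])`). -/
theorem lehnSuper_W {S : SchemeOver ℂ} (hS : IsSmoothProjective 2 S) (H : HilbertSchemesOfPoints S)
    (𝔊 : ChernCharacterOperators hS H) (h𝔊 : 𝔊.IsWZeroModes)
    {C : totalCohomology ℂ (ComplexPoints S) ⊗[ℂ] totalCohomology ℂ (ComplexPoints S)}
    (hCg : C ∈ evenTensorSpan ℂ (coeffFamily S)) (hC : IsCasimir ℂ (poincarePairing hS) C)
    (s : ℕ) (γ : totalCohomology ℂ (ComplexPoints S)) (hγ : γ ∈ LinearMap.range (ofDegree ℂ (ComplexPoints S) s))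
    (n : ℕ) (W : Submodule ℂ (totalCohomology ℂ (ComplexPoints (H.obj n)))) (hcup : IsCupClosed W)
    (hdeg : ∀ c ∈ LinearMap.range (ofDegree ℂ (ComplexPoints (H.obj n)) s), c ∈ W) :
    StableUnder n W (transferOp ℂ 𝔊.q C 1 (totalCup ℂ (ComplexPoints S) γ)) := by
  rw [← h𝔊.cupOperator_zero_eq_transferOp hCg hC γ]
  refine ⟨fun y ↦ ?_, fun w hw ↦ ?_⟩
  · rw [ChernCharacterOperators.cupOperator_apply_ofSummand]
    exact LinearMap.mem_range_self _ _
  · have hres : restrictFock ℂ (fockFamily H) (𝔊.cupOperator 0 γ) n =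
        totalCup ℂ (ComplexPoints (H.obj n)) (𝔊.G 0 n γ) := by
      unfold ChernCharacterOperators.cupOperator
      rw [restrictFock_fiberwise]
    rw [hres]
    obtain ⟨g, rfl⟩ := hγ
    have hG := 𝔊.G_degree 0 n s g
    rw [Nat.mul_zero, Nat.add_zero] at hG
    exact hcup _ (hdeg _ hG) w hw

/-! ### The two stub statements -/

/-- **S-C statement (the `Λ*H¹` model of an abelian surface adapted to a dual Lefschetz pair).** -/
def Model : Prop :=
  ∀ ⦃A : AbelianVariety ℂ⦄, A.dim = 2 → ∀ (hS : IsSmoothProjective 2 A.X) (α : complexBetti A.X 2)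
    (Λ_A : Module.End ℂ (totalCohomology ℂ (ComplexPoints A.X))), IsDualLefschetz 2 α Λ_A →
    ∃ b : Module.Basis (Fin 16) ℂ (totalCohomology ℂ (ComplexPoints A.X)),
      (∀ I, b I ∈ LinearMap.range (ofDegree ℂ (ComplexPoints A.X) (deg4 I))) ∧
      b 0 = ofDegree ℂ (ComplexPoints A.X) 0 (singularCohomology.one ℂ (ComplexPoints A.X)) ∧
      (∀ I, Matrix.toLin b b ((mulMat I).map (Int.castRingHom ℂ)) = totalCup ℂ (ComplexPoints A.X) (b I)) ∧
      Matrix.toLin b b (lamMat.map (Int.castRingHom ℂ)) = Λ_A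

/-- **S-F statement (cut-and-join ∕ polarisation span).** -/
def Span : Prop :=
  ∀ ⦃S : SchemeOver ℂ⦄ (hS : IsSmoothProjective 2 S) (H : HilbertSchemesOfPoints S) (𝔊 : ChernCharacterOperators hS H),
    𝔊.IsWZeroModes →
    ∀ (C : totalCohomology ℂ (ComplexPoints S) ⊗[ℂ] totalCohomology ℂ (ComplexPoints S)),
      C ∈ evenTensorSpan ℂ (coeffFamily S) → IsCasimir ℂ (poincarePairing hS) C →
    ∀ (b : Module.Basis (Fin 16) ℂ (totalCohomology ℂ (ComplexPoints S))),
      (∀ I, b I ∈ LinearMap.range (ofDegree ℂ (ComplexPoints S) (deg4 I))) →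
      b 0 = ofDegree ℂ (ComplexPoints S) 0 (singularCohomology.one ℂ (ComplexPoints S)) →
    ∀ (n : ℕ) (W : Submodule ℂ (totalCohomology ℂ (ComplexPoints (H.obj n)))),
      ofDegree ℂ (ComplexPoints (H.obj n)) 0 (singularCohomology.one ℂ (ComplexPoints (H.obj n))) ∈ W →
      StableUnder n W 𝔊.boundaryOperator →
      (∀ k, 1 ≤ k → k ≤ n →
        (∀ w ∈ W, twoPt 𝔊.toNakajimaOperators C LinearMap.id k n w ∈ W) ∧
          ∀ I : Fin 16, I ≠ 0 → ∀ w ∈ W, twoPt 𝔊.toNakajimaOperators C (polar b 0 I) k n w ∈ W) →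
      W = ⊤

/-! ### Registered stubs -/

/-- STUB `stub_model` (S-C; size M): Darboux basis `e₀,…,e₃` of `H¹(A)` with `α = e₀e₁ + e₂e₃` (`α ∧ α ≠ 0` from the dual
Lefschetz pair, `cupPowTwo_ne_zero_of_isDualLefschetz`), `H*(A) = Λ*H¹(A)` (`abelianVarietyCohomologyExteriorH1_holds`;
p5's `L1Hilb.Model.bvec_mul`, `bvec_mem_range`, `bvec_zero`), and `Λ_A = lamMat` in that basis by `sl₂`-partner uniqueness. -/
theorem stub_model : Model := by
  sorry

/-- STUB `stub_span` (S-F; size M–L): joins `[[𝔡, 𝔮ₐ(1)], 𝔮_b(1)] = −ab·𝔮_{a+b}(1)` (`boundary_bracket`) and the explicit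
cubic `𝔡 = −𝔞_{(3)}(τ_*1_S)` (`IsWZeroModes.boundaryOperator_eq_neg_zeroMode_three`) reach the unit monomial of every shape
from `𝔮₋₁(1)ⁿ|0⟩ = n!·1_{S^[n]}` (`unit_pow`) modulo cuts with more parts (downward induction on the number of parts); the
commuting number operators `τ_k(id)|ₙ` separate shapes; polarisations `τ_k(b_I ⊗ b₀^∨)|ₙ` relabel one unit part at a time
with non-zero coefficients; Nakajima monomials in the basis `b` span `ℍₙ` (`HeisenbergMonomialSpanning`). -/
theorem stub_span : Span := by
  sorry

/-! ### The composition (kernel-checked) -/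

/-- **L1-HilbW(n) for every `n`** from the two stubs and p5's landed S-A ∕ S-D ∕ S-E (by name). -/
theorem lefschetzGenerationHilbW_allN_of (hM : Model) (hSp : Span) (n : ℕ) : LefschetzGenerationHilbW n := by
  intro A hA hS H 𝔊 h𝔊 C hCg hC α Λ_A hΛA
  obtain ⟨b, hb, hb0, hmul, hΛ⟩ := hM hA hS α Λ_A hΛA
  unfold LefschetzGenerationHilbAt
  set W := opCupSpan ℂ (ComplexPoints (H.obj n)) (transferDual 𝔊.toNakajimaOperators C Λ_A n)
    (degreeClasses ℂ (ComplexPoints (H.obj n)) {0, 1, 2, 3}) with hW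
  have hlow : degreeClasses ℂ (ComplexPoints (H.obj n)) {0, 1, 2, 3} ⊆ W := subset_opCupSpan
  have hcup : IsCupClosed W := isCupClosed_opCupSpan
  have hstab : transferDual 𝔊.toNakajimaOperators C Λ_A n ∈ stabilizerLie W := mem_stabilizerLie_opCupSpan
  -- the fourteen generators `T₁(m_{b_I})`, `1 ≤ |I| ≤ 3`, stabilise `W` (S-B, `W`-form, proved above)
  have hgen : ∀ I : Fin 16, deg4 I ∈ ({1, 2, 3} : Set ℕ) →
      StableUnder n W (transferOp ℂ 𝔊.q C 1 (totalCup ℂ (ComplexPoints A.X) (b I))) := by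
    intro I hI
    refine lehnSuper_W hS H 𝔊 h𝔊 hCg hC (deg4 I) (b I) (hb I) n W hcup fun c hc ↦ ?_
    obtain ⟨x, rfl⟩ := hc
    refine hlow (ofDegree_mem_degreeClasses ?_ x)
    simp only [Set.mem_insert_iff, Set.mem_singleton_iff] at hI ⊢
    rcases hI with h | h | h <;> simp [h]
  -- `T₋₁(Λ_A)` stabilises `W` (its block is `transferDual`, which is in the stabiliser by construction)
  have hf : StableUnder n W (transferOp ℂ 𝔊.q C (-1) Λ_A) :=
    ⟨fun y ↦ 𝔊.isHeisenberg.transferOp_apply_ofSummand_mem_range C (-1) Λ_A n y,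
      fun w hw ↦ (mem_stabilizerLie_iff W _).1 hstab w hw⟩
  -- S-E with S-D and S-A plugged in BY NAME
  have hE := L1Hilb.stub_eval L1Hilb.stub_cert 𝔊.toNakajimaOperators hCg hC
    (fun t t' φ ψ d d' hφ hψ ↦ L1Hilb.stub_superLie 𝔊.toNakajimaOperators hCg hC t t' hφ hψ)
    b hb hmul Λ_A hΛ n W hgen hf
  -- `1_{A^[n]} ∈ W` and `W` is `𝔡|ₙ`-stable (cup product with `G₁(1, n) ∈ H²`)
  have h1 : ofDegree ℂ (ComplexPoints (H.obj n)) 0 (singularCohomology.one ℂ (ComplexPoints (H.obj n))) ∈ W :=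
    hlow (ofDegree_mem_degreeClasses (by simp) _)
  have hG1 : 𝔊.G 1 n (unitCoeff A.X) ∈ W := by
    obtain ⟨d, hd⟩ := 𝔊.G_degree 1 n 0 (singularCohomology.one ℂ (ComplexPoints A.X))
    have hd' : ofDegree ℂ (ComplexPoints (H.obj n)) (0 + 2 * 1) d = 𝔊.G 1 n (unitCoeff A.X) := hd
    rw [← hd']
    exact hlow (ofDegree_mem_degreeClasses (by norm_num) d)
  have hd : StableUnder n W 𝔊.boundaryOperator := by
    refine ⟨fun y ↦ ?_, fun w hw ↦ ?_⟩
    · show 𝔊.cupOperator 1 (unitCoeff A.X) _ ∈ _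
      rw [ChernCharacterOperators.cupOperator_apply_ofSummand]
      exact LinearMap.mem_range_self _ _
    · have hres : restrictFock ℂ (fockFamily H) 𝔊.boundaryOperator n =
          totalCup ℂ (ComplexPoints (H.obj n)) (𝔊.G 1 n (unitCoeff A.X)) := by
        unfold ChernCharacterOperators.boundaryOperator ChernCharacterOperators.cupOperator
        rw [restrictFock_fiberwise]
      rw [hres]
      exact hcup _ hG1 w hw
  exact hSp hS H 𝔊 h𝔊 C hCg hC b hb hb0 n W h1 hd hE

/-- **Composition for the route item** `LefschetzGenerationHilb5` (`= LefschetzGenerationHilbW 5`), BY NAME. -/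
theorem LefschetzGenerationHilb5_of : Summit.Ventures.HodgeKum4.Theses.KummerFixedLocus.LefschetzGenerationHilb5 :=
  lefschetzGenerationHilbW_allN_of stub_model stub_span 5

end Summit.Ventures.HodgeKum4.Cruxes.LefschetzGenerationHilb5.V2p5

end
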